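import Mathlib
import Summits.ValiantsHypothesis.ValiantsHypothesis.Theorems.LacunarySymmetroidMatrixDescartesMonotoneFlag

/-!
# `MatrixDescartes` (stmt-ValiantsHypothesis-18050) — THE CONVEXITY LAW OF THE INERTIA WALK for the universal two-sided word:
# PSD letters around an ARBITRARY pivot, ANY exponents ⇒ `ν(F(x₂)) + m ≥ ν(F(x₁)) + ν(F(x₃))` for `x₁ < x₂ < x₃`

HONEST FRAMING.  Cell `pub-symmetroid`, seat `val-sym-mdr-p2` (gen 22); helper file `--supports` the crux
`Theses.LacunarySymmetroid.MatrixDescartes` (OPEN), NO closure claim.  A STRUCTURE LAW for the crux's universal word (the pivot pencils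
`X^e J + Σ X^{d_k} P_k`, `P_k ⪰ 0` on BOTH sides of the pivot, line `Lift` / `stub_twoSided`), stated in the crux currency with the pivot as one
of the letters: nothing here bears on the crux in its window, `stub_twoSided`, `DoorA26` / `DoorA34`, registers, or `VP ≠ VNP`.

SETTING.  Real symmetric letters `S l` (`l : κ`) of size `ι` (`m = card ι`), exponents `d l` (ARBITRARY, ties allowed), a pivot index
`l₀`, and every OTHER letter positive semidefinite (no side condition: letters may sit below, at, or above the pivot exponent).
`F(x) = Σ_l x^{d l} S l`, `ν(F(x))` its negative index.

* `convex_comb_zpow_le` — three-point convexity of `x ↦ x^n` (`n : ℤ`) on `(0,∞)` (Mathlib `convexOn_zpow`).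
* `form_pencil_eq_zpow` — `vᵀF(x)v = x^{d l₀} · Σ_l x^{(d l) − (d l₀)} vᵀS_lv` (integer exponents).
* **`negIndex_convexity` (THE CONVEXITY LAW OF THE INERTIA WALK).**  For `0 < x₁ < x₂ < x₃`:
      `ν(F(x₂)) + card ι ≥ ν(F(x₁)) + ν(F(x₃))`.
  PROOF: every Rayleigh quotient `x^{−d₀}vᵀF(x)v = vᵀS₀v + Σ_{l≠l₀} x^{d_l−d₀}(vᵀS_lv)` is CONVEX on `(0,∞)` (non-negative combination of
  integer powers), so the intersection of the negative eigenspaces of `F(x₁)` and `F(x₃)` — of dimension `≥ ν₁ + ν₃ − m`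
  (`Submodule.finrank_sup_add_finrank_inf_eq`) — is a negative-definite subspace for `F(x₂)`; Sylvester in family language
  (`Inertia.card_le_negIndex`) on a basis of it.
* COROLLARIES: `negIndex_dip_le` — a dip of the walk between two scales is bounded by the complementary index of the LATER scale,
  `ν(F(x₁)) − ν(F(x₂)) ≤ m − ν(F(x₃))` (revival DEPTH is bounded; with pivot index `q`, `ν ≤ q` throughout by
  `…CensusPivotIndexRung`, so deep revivals need a small index at some later scale); `negIndex_eq_card_between` — `ν = m` at two scales
  ⇒ `ν = m` between (the inertia form of the tree's negative-moment law `MomentLaw.negMoment_*`, which uses the same convexity of the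
  Rayleigh quotients).
LOCATED (memo FLAG-EXACT.md §4): the law allows the pattern `0,1,0,1,0,1` of the walk (no total-variation bound follows; `n = 2` NSD-pivot
columns realise `Z₊ = 2K`), so it is a constraint on the DEPTH of revivals, not on their number.

[folklore] (convexity of integer powers; Sylvester's law of inertia in family language).  Axioms `propext`, `Classical.choice`, `Quot.sound`.
No definitions.
-/

-- layout Summits/ValiantsHypothesis/ValiantsHypothesis forces the duplicated namespace component
set_option linter.dupNamespace false

namespace Summit.ValiantsHypothesis.ValiantsHypothesis.Theorems.LacunarySymmetroidMatrixDescartes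

open Polynomial Matrix Finset
open scoped BigOperators

namespace Inertia

section Convexity

variable {ι κ : Type} [Fintype ι] [DecidableEq ι] [Fintype κ] [DecidableEq κ]

omit [Fintype ι] [DecidableEq ι] [Fintype κ] [DecidableEq κ] in
/-- Three-point convexity of integer powers on `(0,∞)`: for `0 < x₁ < x₂ < x₃` and `t = (x₂ − x₁)/(x₃ − x₁)`,
`x₂^n ≤ (1 − t)·x₁^n + t·x₃^n`. [folklore] -/
theorem convex_comb_zpow_le (n : ℤ) {x₁ x₂ x₃ : ℝ} (h₁ : 0 < x₁) (h₁₂ : x₁ < x₂) (h₂₃ : x₂ < x₃) :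
    x₂ ^ n ≤ (1 - (x₂ - x₁) / (x₃ - x₁)) * x₁ ^ n + (x₂ - x₁) / (x₃ - x₁) * x₃ ^ n := by
  have h₃ : 0 < x₃ := by linarith
  have hd : 0 < x₃ - x₁ := by linarith
  set t : ℝ := (x₂ - x₁) / (x₃ - x₁) with ht
  have ht0 : 0 ≤ t := by rw [ht]; positivity
  have ht1 : t ≤ 1 := by rw [ht, div_le_one hd]; linarith
  have hcomb : (1 - t) * x₁ + t * x₃ = x₂ := by
    rw [ht]; field_simp; ring
  have h := (convexOn_zpow n : ConvexOn ℝ (Set.Ioi (0:ℝ)) fun x : ℝ => x ^ n).2 (Set.mem_Ioi.2 h₁) (Set.mem_Ioi.2 h₃)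
    (by linarith : 0 ≤ 1 - t) ht0 (by ring : 1 - t + t = 1)
  simp only [smul_eq_mul] at h
  rw [hcomb] at h
  exact h

omit [DecidableEq ι] [DecidableEq κ] in
/-- The Rayleigh quotient of the pencil in integer-power form: `vᵀF(x)v = x^{d l₀} Σ_l x^{d l − d l₀} vᵀS_lv` (`x > 0`). [folklore] -/
theorem form_pencil_eq_zpow (d : κ → ℕ) (S : κ → Matrix ι ι ℝ) (l₀ : κ) {x : ℝ} (hx : 0 < x) (v : ι → ℝ) :
    v ⬝ᵥ ((∑ l, x ^ d l • S l) *ᵥ v) = x ^ d l₀ * ∑ l, x ^ ((d l : ℤ) - (d l₀ : ℤ)) * (v ⬝ᵥ (S l *ᵥ v)) := by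
  simp only [Matrix.sum_mulVec, dotProduct_sum, Matrix.smul_mulVec, dotProduct_smul, smul_eq_mul, Finset.mul_sum]
  refine Finset.sum_congr rfl fun l _ => ?_
  rw [← mul_assoc]
  congr 1
  rw [← zpow_natCast, ← zpow_natCast, ← zpow_add₀ hx.ne']
  congr 1
  ring

omit [DecidableEq κ] in
/-- **THE CONVEXITY LAW OF THE INERTIA WALK.**  Real symmetric letters, all but the pivot letter `S l₀` positive semidefinite, ARBITRARY
exponents: for `0 < x₁ < x₂ < x₃`, `ν(F(x₂)) + card ι ≥ ν(F(x₁)) + ν(F(x₃))`. [folklore] -/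
theorem negIndex_convexity (d : κ → ℕ) (S : κ → Matrix ι ι ℝ) (hS : ∀ l, (S l).IsSymm) (l₀ : κ)
    (hpsd : ∀ l, l ≠ l₀ → (S l).PosSemidef) {x₁ x₂ x₃ : ℝ} (h₁ : 0 < x₁) (h₁₂ : x₁ < x₂) (h₂₃ : x₂ < x₃) :
    Fintype.card {j // (isHermitian_pencil d S hS x₁).eigenvalues j < 0}
        + Fintype.card {j // (isHermitian_pencil d S hS x₃).eigenvalues j < 0}
      ≤ Fintype.card {j // (isHermitian_pencil d S hS x₂).eigenvalues j < 0} + Fintype.card ι := by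
  classical
  have h₂ : 0 < x₂ := by linarith
  have h₃ : 0 < x₃ := by linarith
  set hF₁ := isHermitian_pencil d S hS x₁
  set hF₂ := isHermitian_pencil d S hS x₂
  set hF₃ := isHermitian_pencil d S hS x₃
  -- the two negative eigenspaces
  set e₁ : {j // hF₁.eigenvalues j < 0} → ι → ℝ := fun j => (hF₁.eigenvectorBasis j.1).ofLp with he₁
  set e₃ : {j // hF₃.eigenvalues j < 0} → ι → ℝ := fun j => (hF₃.eigenvectorBasis j.1).ofLp with he₃
  set s₁ : Submodule ℝ (ι → ℝ) := Submodule.span ℝ (Set.range e₁) with hs₁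
  set s₃ : Submodule ℝ (ι → ℝ) := Submodule.span ℝ (Set.range e₃) with hs₃
  have hli₁ : LinearIndependent ℝ e₁ := linearIndependent_subtype_eigen hF₁ _
  have hli₃ : LinearIndependent ℝ e₃ := linearIndependent_subtype_eigen hF₃ _
  have hr₁ : Module.finrank ℝ s₁ = Fintype.card {j // hF₁.eigenvalues j < 0} := by
    rw [hs₁]; exact finrank_span_eq_card hli₁
  have hr₃ : Module.finrank ℝ s₃ = Fintype.card {j // hF₃.eigenvalues j < 0} := by
    rw [hs₃]; exact finrank_span_eq_card hli₃
  have hsum := Submodule.finrank_sup_add_finrank_inf_eq s₁ s₃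
  have hsup : Module.finrank ℝ ↥(s₁ ⊔ s₃) ≤ Fintype.card ι := by
    have h := Submodule.finrank_le (s₁ ⊔ s₃)
    rwa [Module.finrank_fintype_fun_eq_card] at h
  -- negativity on each span
  have hneg₁ : ∀ v ∈ s₁, v ≠ 0 → v ⬝ᵥ ((∑ l, x₁ ^ d l • S l) *ᵥ v) < 0 := by
    intro v hv hv0
    obtain ⟨c, rfl⟩ := (Submodule.mem_span_range_iff_exists_fun ℝ).1 hv
    have hc : c ≠ 0 := fun h => hv0 (by rw [h]; simp)
    exact neg_eigenFamily hF₁ c hc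
  have hneg₃ : ∀ v ∈ s₃, v ≠ 0 → v ⬝ᵥ ((∑ l, x₃ ^ d l • S l) *ᵥ v) < 0 := by
    intro v hv hv0
    obtain ⟨c, rfl⟩ := (Submodule.mem_span_range_iff_exists_fun ℝ).1 hv
    have hc : c ≠ 0 := fun h => hv0 (by rw [h]; simp)
    exact neg_eigenFamily hF₃ c hc
  -- convexity: negative at x₁ and x₃ ⇒ negative at x₂
  have hneg₂ : ∀ v ∈ s₁ ⊓ s₃, v ≠ 0 → v ⬝ᵥ ((∑ l, x₂ ^ d l • S l) *ᵥ v) < 0 := by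
    intro v hv hv0
    have q₁ := hneg₁ v (Submodule.mem_inf.1 hv).1 hv0
    have q₃ := hneg₃ v (Submodule.mem_inf.1 hv).2 hv0
    rw [form_pencil_eq_zpow d S l₀ h₁] at q₁
    rw [form_pencil_eq_zpow d S l₀ h₃] at q₃
    rw [form_pencil_eq_zpow d S l₀ h₂]
    have hq₁ : ∑ l, x₁ ^ ((d l : ℤ) - (d l₀ : ℤ)) * (v ⬝ᵥ (S l *ᵥ v)) < 0 := by
      rcases lt_or_ge (∑ l, x₁ ^ ((d l : ℤ) - (d l₀ : ℤ)) * (v ⬝ᵥ (S l *ᵥ v))) 0 with h' | h'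
      · exact h'
      · exact absurd q₁ (not_lt.2 (mul_nonneg (pow_nonneg h₁.le _) h'))
    have hq₃ : ∑ l, x₃ ^ ((d l : ℤ) - (d l₀ : ℤ)) * (v ⬝ᵥ (S l *ᵥ v)) < 0 := by
      rcases lt_or_ge (∑ l, x₃ ^ ((d l : ℤ) - (d l₀ : ℤ)) * (v ⬝ᵥ (S l *ᵥ v))) 0 with h' | h'
      · exact h'
      · exact absurd q₃ (not_lt.2 (mul_nonneg (pow_nonneg h₃.le _) h'))
    set t : ℝ := (x₂ - x₁) / (x₃ - x₁) with ht
    have ht0 : 0 ≤ t := by rw [ht]; exact div_nonneg (by linarith) (by linarith)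
    have ht1 : t ≤ 1 := by rw [ht, div_le_one (by linarith)]; linarith
    -- termwise three-point convexity
    have hterm : ∀ l, x₂ ^ ((d l : ℤ) - (d l₀ : ℤ)) * (v ⬝ᵥ (S l *ᵥ v))
        ≤ (1 - t) * (x₁ ^ ((d l : ℤ) - (d l₀ : ℤ)) * (v ⬝ᵥ (S l *ᵥ v))) + t * (x₃ ^ ((d l : ℤ) - (d l₀ : ℤ)) * (v ⬝ᵥ (S l *ᵥ v))) := by
      intro l
      by_cases hl : l = l₀
      · subst hl
        simp only [sub_self, zpow_zero, one_mul]
        nlinarith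
      · have hq : 0 ≤ v ⬝ᵥ (S l *ᵥ v) := by simpa only [star_trivial] using (hpsd l hl).dotProduct_mulVec_nonneg v
        have hc := convex_comb_zpow_le ((d l : ℤ) - (d l₀ : ℤ)) h₁ h₁₂ h₂₃
        rw [← ht] at hc
        nlinarith
    have hle : ∑ l, x₂ ^ ((d l : ℤ) - (d l₀ : ℤ)) * (v ⬝ᵥ (S l *ᵥ v))
        ≤ (1 - t) * ∑ l, x₁ ^ ((d l : ℤ) - (d l₀ : ℤ)) * (v ⬝ᵥ (S l *ᵥ v))
          + t * ∑ l, x₃ ^ ((d l : ℤ) - (d l₀ : ℤ)) * (v ⬝ᵥ (S l *ᵥ v)) := by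
      rw [Finset.mul_sum, Finset.mul_sum, ← Finset.sum_add_distrib]
      exact Finset.sum_le_sum fun l _ => hterm l
    have hneg : ∑ l, x₂ ^ ((d l : ℤ) - (d l₀ : ℤ)) * (v ⬝ᵥ (S l *ᵥ v)) < 0 := by
      rcases eq_or_lt_of_le ht0 with ht0' | ht0'
      · rw [← ht0'] at hle; linarith
      · nlinarith
    exact mul_neg_of_pos_of_neg (pow_pos h₂ _) hneg
  -- a basis of the intersection is a negative family for `F(x₂)`
  set b := Module.finBasis ℝ ↥(s₁ ⊓ s₃) with hb
  set w : Fin (Module.finrank ℝ ↥(s₁ ⊓ s₃)) → ι → ℝ := fun i => ((b i : ↥(s₁ ⊓ s₃)) : ι → ℝ) with hw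
  have hwneg : ∀ c : Fin (Module.finrank ℝ ↥(s₁ ⊓ s₃)) → ℝ, c ≠ 0 →
      (∑ i, c i • w i) ⬝ᵥ ((∑ l, x₂ ^ d l • S l) *ᵥ ∑ i, c i • w i) < 0 := by
    intro c hc
    have hmem : (∑ i, c i • w i) ∈ s₁ ⊓ s₃ := by
      refine Submodule.sum_mem _ fun i _ => Submodule.smul_mem _ _ ?_
      exact (b i).2
    have hne : (∑ i, c i • w i) ≠ 0 := by
      intro h0
      have hcomb : (∑ i, c i • (b i : ↥(s₁ ⊓ s₃))) = 0 := by
        apply Subtype.ext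
        rw [Submodule.coe_sum, ZeroMemClass.coe_zero]
        simpa only [hw, Submodule.coe_smul] using h0
      have := Fintype.linearIndependent_iff.1 b.linearIndependent c hcomb
      exact hc (funext this)
    exact hneg₂ _ hmem hne
  have hcount := card_le_negIndex hF₂ w hwneg
  rw [Fintype.card_fin] at hcount
  omega

omit [DecidableEq κ] in
/-- **Dip bound**: between two scales the negative index cannot fall below `ν(F(x₁)) + ν(F(x₃)) − m`; equivalently a dip below a later
level costs at most the complementary index of that level: `ν(F(x₁)) − ν(F(x₂)) ≤ card ι − ν(F(x₃))`. [folklore] -/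
theorem negIndex_dip_le (d : κ → ℕ) (S : κ → Matrix ι ι ℝ) (hS : ∀ l, (S l).IsSymm) (l₀ : κ)
    (hpsd : ∀ l, l ≠ l₀ → (S l).PosSemidef) {x₁ x₂ x₃ : ℝ} (h₁ : 0 < x₁) (h₁₂ : x₁ < x₂) (h₂₃ : x₂ < x₃) :
    Fintype.card {j // (isHermitian_pencil d S hS x₁).eigenvalues j < 0}
        - Fintype.card {j // (isHermitian_pencil d S hS x₂).eigenvalues j < 0}
      ≤ Fintype.card ι - Fintype.card {j // (isHermitian_pencil d S hS x₃).eigenvalues j < 0} := by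
  have h := negIndex_convexity d S hS l₀ hpsd h₁ h₁₂ h₂₃
  have h3 : Fintype.card {j // (isHermitian_pencil d S hS x₃).eigenvalues j < 0} ≤ Fintype.card ι := Fintype.card_subtype_le _
  omega

omit [DecidableEq κ] in
/-- **Negative definiteness propagates between scales**: `ν(F(x₁)) = ν(F(x₃)) = m` ⇒ `ν(F(x₂)) = m`. [folklore] -/
theorem negIndex_eq_card_between (d : κ → ℕ) (S : κ → Matrix ι ι ℝ) (hS : ∀ l, (S l).IsSymm) (l₀ : κ)
    (hpsd : ∀ l, l ≠ l₀ → (S l).PosSemidef) {x₁ x₂ x₃ : ℝ} (h₁ : 0 < x₁) (h₁₂ : x₁ < x₂) (h₂₃ : x₂ < x₃)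
    (hx₁ : Fintype.card {j // (isHermitian_pencil d S hS x₁).eigenvalues j < 0} = Fintype.card ι)
    (hx₃ : Fintype.card {j // (isHermitian_pencil d S hS x₃).eigenvalues j < 0} = Fintype.card ι) :
    Fintype.card {j // (isHermitian_pencil d S hS x₂).eigenvalues j < 0} = Fintype.card ι := by
  have h := negIndex_convexity d S hS l₀ hpsd h₁ h₁₂ h₂₃
  have h2 : Fintype.card {j // (isHermitian_pencil d S hS x₂).eigenvalues j < 0} ≤ Fintype.card ι := Fintype.card_subtype_le _
  omega

end Convexity

end Inertia

end Summit.ValiantsHypothesis.ValiantsHypothesis.Theorems.LacunarySymmetroidMatrixDescartes
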